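import Summits.QuantumFields.YangMills.Theorems.UnitScaleTiltProp7TorusRadialSums
import HarnessLib

/-!
# Route `UnitScaleTilt`, crux K1 «MinimiserStabilityRegPr» (stmt-QuantumFields-19200), route-R E′ path (α′), (E1-b)-cov ∕ (N-cov) near-field transplant — FLAT-CONV letters, FILE 2:
# TORUS-GREEN CONVOLUTION BOUNDS AGAINST AN `r⁻²` DENSITY IN A BALL.  For a weight `0 ≤ w ≤ A·(1 ∨ r)⁻²` supported in the `tdist`-ball of radius `R` about a pole `y₀` and a kernel known
# ONLY through a decay row `|k(z)| ≤ c·(1 ∨ tdist(z,x))^{−a}` (`a = 2, 1, 0`) or the growth row `|k(z)| ≤ c·(1 + tdist(z,x))` (`a = −1`), at every `x` with `tdist(x,y₀) ≤ 2R`: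
# `Σ_z |k z|·w z ≤ C·c·A × {(1 ∨ r_x)⁻¹, √(3R∕(1 ∨ r_x)), R, R(R + r_x)}` — LOG-FREE, volume-free, d = 3 (routeR-w6 g6's Q1–Q3 of 2026-08-28T22:12Z); THIS FILE (2a):
# the helpers, the split geometry, and the exponents a = 0, −1; FILE 2b `…TorusGreenConvolutionDecay`: a = 2, 1

Cell `ym3-torus`, D-0154 (3c) twin-width seat `ym-routeR-w3` (gen 6); «FLAT-CONV — MINE» for routeR-w6 g6's LOCATE-PCOV2 v1.2 §5 (the second-generation transplant reads `G̃₁`, `∇G̃₁`, `∇^{0,1,2}G̃₂`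
against the framed junk density `≲ a·‖Y‖·(1 ∨ r)⁻²`).  Engine: ✓ `Prop7TorusRadialSums` (layer cake + ball count).  THEOREMS ONLY (0 `def`, 0 `sorry`); `--supports stmt-QuantumFields-19200`, count-neutral.
YM₃ on T³ is a ladder rung (R3), not the Clay problem; nothing here claims the stub, the crux, d = 4 or the gap.

THE SPLIT (a = 2, 1).  With `r_z := tdist(z,y₀)`, `t_z := tdist(z,x)`, `ρ := tdist(x,y₀)`, the triangle inequality `ρ ≤ t_z + r_z` puts every `z` in `A := {r_z ≤ t_z}` (then `2t_z ≥ ρ`, and the kernel is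
small: `(1∨t_z)^{−a} ≤ min(2^a(1∨ρ)^{−a}, (1∨r_z)^{−a})`) or in `B := {t_z < r_z}` (then `2r_z > ρ` and the density is small); each is halved at `h := ⌊ρ∕2⌋`: the inner halves are radial sums of
`(1∨·)⁻²` resp. `(1∨·)^{−a}` up to `h` times the frozen factor, the outer halves are tails `Σ_{>h} r^{−a−2}` (✓ `sum_inv_tdist_pow_four_le` ∕ ✓ `sum_inv_tdist_cube_le` with the harmonic tail majorised
LOG-FREE by `Σ_{t≥M} t⁻¹ ≤ 2√N∕√M`).

WHAT IS PROVED (ns `…Theorems.Prop7TorusGreenConvolution`; torus `Site P j` with `P.d = 3`).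
* §1 `sum_sqrt_sub_sqrt`, ★ `sum_Ico_inv_le_two_sqrt` (`Σ_{t∈[M,N)} t⁻¹ ≤ 2√N∕√M`), `card_centre_le` (`#{tdist ≤ 0} ≤ 8`), ★ `sum_inv_max_sq_le` (`Σ_{tdist≤N} (1∨r)⁻² ≤ 8 + 192N`),
  `sum_inv_max_le` (`≤ 8 + 128N²`), `sum_inv_cube_tail_le_sqrt` (`Σ_{M≤r≤N} r⁻³ ≤ 64 + 384√N∕√M`).
* §2 `mem_of_mem_filter_filter`, `sum_eq_sum_ball`, ★★ `conv_bdd_le` (a = 0: `≤ c·A·(8 + 192R)`), ★★ `conv_lin_le` (a = −1: `≤ c·A·((1 + ρ)(8 + 192R) + 8 + 128R²)`), and the split geometry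
  `max_rho_le_two_max_of_le` ∕ `_of_lt` ∕ `max_rho_le_two_half_add_one`; the decaying exponents a = 2, 1 (★★★ `conv_inv_sq_le`, ★★★ `conv_inv_le`) are FILE 2b
  `…TorusGreenConvolutionDecay` (the 400-line rule).
* §3 ★★ `norm_sum_smul_le_of_conv` — the matrix∕vector corollary: `‖Σ_z k z • J z‖ ≤ Σ_z |k z|·‖J z‖`, so each §2 bound holds for `‖Σ_z k(x,z) • J z‖` with `w := ‖J ·‖`.
HONEST SCOPE.  Counting only; the kernel rows are DISPLAYED (suppliers: ✓p667495 `torusGreen_mul_dist_le` (a = 1), ✓p659194 (a = 2), ✓p663183∕p662426∕p662832 (G̃₂: a = −1, 0, 1), read through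
✓p662720's `tdist² ≤ d·Σz̃²`); constants crude and ours.

References: G. F. Lawler, V. Limic, *Random Walk: A Modern Introduction*, CUP 2010, §6.3 [LawlerLimic2010] (orientation); T. Bałaban, CMP 99 (1985) 75–102 [Balaban1985RegularSpaces] ((1.36) p.82).
-/

set_option autoImplicit false

noncomputable section

open scoped BigOperators
open Finset

namespace Summit.QuantumFields.YangMills.Theorems.Prop7TorusGreenConvolution

open Literature.MathematicalPhysics.QuantumFieldTheory.Balaban1983to89
open B3Taylor310LocalRemainder (tdist_comm tdist_triangle tdist_self)
open Summit.QuantumFields.YangMills.Theorems.Prop7TorusRadialSums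

variable {P : Params} {j : ℕ}

/-! ## §1 Log-free tails and ball sums with the `1 ∨ r` profile -/

/-- telescoping `Σ_{t∈[M,N)} (√t − √(t−1)) = √(N−1) − √(M−1)` (`1 ≤ M ≤ N`). [folklore] -/
theorem sum_sqrt_sub_sqrt {M N : ℕ} (hMN : M ≤ N) :
    ∑ t ∈ Ico M N, (Real.sqrt t - Real.sqrt ((t : ℝ) - 1)) = Real.sqrt ((N : ℝ) - 1) - Real.sqrt ((M : ℝ) - 1) := by
  induction N, hMN using Nat.le_induction with
  | base => simp
  | succ N hN ih =>
      rw [Finset.sum_Ico_succ_top hN, ih]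
      push_cast
      ring

/-- ★ **LOG-FREE HARMONIC TAIL**: `Σ_{t∈[M,N)} t⁻¹ ≤ 2√N∕√M` for `1 ≤ M` (`t⁻¹ ≤ M^{−1∕2}t^{−1∕2}` and `t^{−1∕2} ≤ 2(√t − √(t−1))`). [folklore] -/
theorem sum_Ico_inv_le_two_sqrt {M N : ℕ} (hM : 1 ≤ M) : ∑ t ∈ Ico M N, ((t : ℝ))⁻¹ ≤ 2 * Real.sqrt N / Real.sqrt M := by
  have hM0 : (0 : ℝ) < M := by exact_mod_cast hM
  have hsM : 0 < Real.sqrt M := Real.sqrt_pos.mpr hM0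
  by_cases hMN : M ≤ N
  · have hterm : ∀ t ∈ Ico M N, ((t : ℝ))⁻¹ ≤ (Real.sqrt M)⁻¹ * (2 * (Real.sqrt t - Real.sqrt ((t : ℝ) - 1))) := by
      intro t ht
      rw [Finset.mem_Ico] at ht
      have ht1 : (1 : ℝ) ≤ t := by exact_mod_cast hM.trans ht.1
      have ht0 : (0 : ℝ) < t := by linarith
      have hMt : (M : ℝ) ≤ t := by exact_mod_cast ht.1
      have hst : 0 < Real.sqrt t := Real.sqrt_pos.mpr ht0
      have hst1 : 0 ≤ Real.sqrt ((t : ℝ) - 1) := Real.sqrt_nonneg _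
      -- `1/√t ≤ 2(√t − √(t−1))`
      have hdiff : (Real.sqrt t)⁻¹ ≤ 2 * (Real.sqrt t - Real.sqrt ((t : ℝ) - 1)) := by
        have e : Real.sqrt t - Real.sqrt ((t : ℝ) - 1) = 1 / (Real.sqrt t + Real.sqrt ((t : ℝ) - 1)) := by
          have h1 : Real.sqrt t ^ 2 = t := Real.sq_sqrt ht0.le
          have h2 : Real.sqrt ((t : ℝ) - 1) ^ 2 = t - 1 := Real.sq_sqrt (by linarith)
          have hpos : 0 < Real.sqrt t + Real.sqrt ((t : ℝ) - 1) := by linarith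
          field_simp
          nlinarith
        rw [e]
        have hle : Real.sqrt ((t : ℝ) - 1) ≤ Real.sqrt t := Real.sqrt_le_sqrt (by linarith)
        rw [inv_eq_one_div, div_le_iff₀ hst, mul_comm, ← mul_assoc, mul_one_div]
        rw [le_div_iff₀ (by linarith)]
        nlinarith
      -- `1/t = (1/√t)(1/√t) ≤ (1/√M)(1/√t)`
      have hsMt : Real.sqrt M ≤ Real.sqrt t := Real.sqrt_le_sqrt hMt
      calc ((t : ℝ))⁻¹ = (Real.sqrt t)⁻¹ * (Real.sqrt t)⁻¹ := by
            rw [← mul_inv, Real.mul_self_sqrt ht0.le]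
        _ ≤ (Real.sqrt M)⁻¹ * (Real.sqrt t)⁻¹ := mul_le_mul_of_nonneg_right (inv_anti₀ hsM hsMt) (inv_nonneg.mpr hst.le)
        _ ≤ (Real.sqrt M)⁻¹ * (2 * (Real.sqrt t - Real.sqrt ((t : ℝ) - 1))) := mul_le_mul_of_nonneg_left hdiff (inv_nonneg.mpr hsM.le)
    calc ∑ t ∈ Ico M N, ((t : ℝ))⁻¹ ≤ ∑ t ∈ Ico M N, (Real.sqrt M)⁻¹ * (2 * (Real.sqrt t - Real.sqrt ((t : ℝ) - 1))) := Finset.sum_le_sum hterm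
      _ = (Real.sqrt M)⁻¹ * (2 * (Real.sqrt ((N : ℝ) - 1) - Real.sqrt ((M : ℝ) - 1))) := by
          rw [← Finset.mul_sum, ← Finset.mul_sum, sum_sqrt_sub_sqrt hMN]
      _ ≤ (Real.sqrt M)⁻¹ * (2 * Real.sqrt N) := by
          refine mul_le_mul_of_nonneg_left ?_ (inv_nonneg.mpr hsM.le)
          have h1 : Real.sqrt ((N : ℝ) - 1) ≤ Real.sqrt N := Real.sqrt_le_sqrt (by linarith)
          have h2 : 0 ≤ Real.sqrt ((M : ℝ) - 1) := Real.sqrt_nonneg _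
          linarith
      _ = 2 * Real.sqrt N / Real.sqrt M := by rw [div_eq_inv_mul]
  · rw [Finset.Ico_eq_empty (by omega), Finset.sum_empty]
    positivity

/-- `#{z : tdist z y ≤ 0} ≤ 8` (d = 3; the ball count at radius 0). [folklore] -/
theorem card_centre_le (hd : P.d = 3) (y : Site P j) : (((univ : Finset (Site P j)).filter fun z => Site.tdist z y ≤ 0).card : ℝ) ≤ 8 := by
  have h := card_ball_le_real (P := P) (j := j) y 0
  have e : (2 * (((0 : ℕ) : ℝ) + 1)) ^ P.d = 8 := by rw [hd]; norm_num
  exact h.trans_eq e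

/-- ★ `Σ_{z∈S} (1 ∨ tdist z y)⁻² ≤ 8 + 192N` for `S ⊆ {tdist(·,y) ≤ N}` (d = 3). [folklore] -/
theorem sum_inv_max_sq_le (hd : P.d = 3) (S : Finset (Site P j)) (y : Site P j) (N : ℕ) (hS : ∀ z ∈ S, Site.tdist z y ≤ N) :
    ∑ z ∈ S, ((max 1 ((Site.tdist z y : ℕ) : ℝ)) ^ 2)⁻¹ ≤ 8 + 192 * (N : ℝ) := by
  classical
  rw [← Finset.sum_filter_add_sum_filter_not S (fun z => Site.tdist z y ≤ 0)]
  refine add_le_add ?_ ?_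
  · -- the centre: each term `≤ 1`, at most 8 of them
    calc ∑ z ∈ S.filter (fun z => Site.tdist z y ≤ 0), ((max 1 ((Site.tdist z y : ℕ) : ℝ)) ^ 2)⁻¹
        ≤ ∑ _z ∈ S.filter (fun z => Site.tdist z y ≤ 0), (1 : ℝ) := Finset.sum_le_sum fun z _ => by
            apply inv_le_one_of_one_le₀
            nlinarith [le_max_left (1 : ℝ) ((Site.tdist z y : ℕ) : ℝ)]
      _ = ((S.filter fun z => Site.tdist z y ≤ 0).card : ℝ) := by simp
      _ ≤ (((univ : Finset (Site P j)).filter fun z => Site.tdist z y ≤ 0).card : ℝ) := by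
            exact_mod_cast Finset.card_le_card (Finset.filter_subset_filter _ (Finset.subset_univ S))
      _ ≤ 8 := card_centre_le hd y
  · -- `1 ≤ r ≤ N`
    by_cases hN : 1 ≤ N
    · have hS' : ∀ z ∈ S.filter (fun z => ¬ Site.tdist z y ≤ 0), 1 ≤ Site.tdist z y ∧ Site.tdist z y ≤ N := by
        intro z hz
        rw [Finset.mem_filter] at hz
        exact ⟨by omega, hS z hz.1⟩
      have h := sum_inv_tdist_sq_le hd (S.filter fun z => ¬ Site.tdist z y ≤ 0) y le_rfl hN hS'
      refine le_trans (Finset.sum_le_sum fun z hz => ?_) h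
      have h1 : (1 : ℝ) ≤ ((Site.tdist z y : ℕ) : ℝ) := by exact_mod_cast (hS' z hz).1
      rw [max_eq_right h1]
    · have hempty : S.filter (fun z => ¬ Site.tdist z y ≤ 0) = ∅ := by
        refine Finset.filter_false_of_mem fun z hz => ?_
        have := hS z hz
        omega
      rw [hempty, Finset.sum_empty]
      positivity

/-- `Σ_{z∈S} (1 ∨ tdist z y)⁻¹ ≤ 8 + 128N²` for `S ⊆ {tdist(·,y) ≤ N}` (d = 3). [folklore] -/
theorem sum_inv_max_le (hd : P.d = 3) (S : Finset (Site P j)) (y : Site P j) (N : ℕ) (hS : ∀ z ∈ S, Site.tdist z y ≤ N) :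
    ∑ z ∈ S, (max 1 ((Site.tdist z y : ℕ) : ℝ))⁻¹ ≤ 8 + 128 * (N : ℝ) ^ 2 := by
  classical
  rw [← Finset.sum_filter_add_sum_filter_not S (fun z => Site.tdist z y ≤ 0)]
  refine add_le_add ?_ ?_
  · calc ∑ z ∈ S.filter (fun z => Site.tdist z y ≤ 0), (max 1 ((Site.tdist z y : ℕ) : ℝ))⁻¹
        ≤ ∑ _z ∈ S.filter (fun z => Site.tdist z y ≤ 0), (1 : ℝ) := Finset.sum_le_sum fun z _ =>
            inv_le_one_of_one_le₀ (le_max_left _ _)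
      _ = ((S.filter fun z => Site.tdist z y ≤ 0).card : ℝ) := by simp
      _ ≤ (((univ : Finset (Site P j)).filter fun z => Site.tdist z y ≤ 0).card : ℝ) := by
            exact_mod_cast Finset.card_le_card (Finset.filter_subset_filter _ (Finset.subset_univ S))
      _ ≤ 8 := card_centre_le hd y
  · by_cases hN : 1 ≤ N
    · have hS' : ∀ z ∈ S.filter (fun z => ¬ Site.tdist z y ≤ 0), 1 ≤ Site.tdist z y ∧ Site.tdist z y ≤ N := by
        intro z hz
        rw [Finset.mem_filter] at hz
        exact ⟨by omega, hS z hz.1⟩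
      have h := sum_inv_tdist_le hd (S.filter fun z => ¬ Site.tdist z y ≤ 0) y le_rfl hN hS'
      refine le_trans (Finset.sum_le_sum fun z hz => ?_) h
      have h1 : (1 : ℝ) ≤ ((Site.tdist z y : ℕ) : ℝ) := by exact_mod_cast (hS' z hz).1
      rw [max_eq_right h1]
    · have hempty : S.filter (fun z => ¬ Site.tdist z y ≤ 0) = ∅ := by
        refine Finset.filter_false_of_mem fun z hz => ?_
        have := hS z hz
        omega
      rw [hempty, Finset.sum_empty]
      positivity

/-- `Σ_{z∈S} (tdist z y)⁻³ ≤ 64 + 384·√N∕√M` for `S ⊆ {1 ≤ M ≤ tdist(·,y) ≤ N}` (d = 3) — ✓ `sum_inv_tdist_cube_le` with the LOG-FREE tail. [folklore] -/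
theorem sum_inv_cube_tail_le_sqrt (hd : P.d = 3) (S : Finset (Site P j)) (y : Site P j) {M N : ℕ} (hM : 1 ≤ M) (hMN : M ≤ N)
    (hS : ∀ z ∈ S, M ≤ Site.tdist z y ∧ Site.tdist z y ≤ N) :
    ∑ z ∈ S, ((((Site.tdist z y : ℕ) : ℝ)) ^ 3)⁻¹ ≤ 64 + 384 * (Real.sqrt N / Real.sqrt M) := by
  have h := sum_inv_tdist_cube_le hd S y hM hMN hS
  have h2 := sum_Ico_inv_le_two_sqrt (N := N) hM
  calc _ ≤ 64 + 192 * ∑ t ∈ Ico M N, ((t : ℝ))⁻¹ := h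
    _ ≤ 64 + 192 * (2 * Real.sqrt N / Real.sqrt M) := by linarith
    _ = 64 + 384 * (Real.sqrt N / Real.sqrt M) := by ring

/-! ## §2 The convolution bounds -/

section Conv

variable (y₀ x : Site P j) (R : ℕ) (k w : Site P j → ℝ) {c A : ℝ}

/-- unpacking a doubly filtered membership. [folklore] -/
theorem mem_of_mem_filter_filter {α : Type*} {S : Finset α} {p q : α → Prop} [DecidablePred p] [DecidablePred q] {z : α}
    (hz : z ∈ (S.filter p).filter q) : z ∈ S ∧ p z ∧ q z := by
  obtain ⟨h1, h2⟩ := Finset.mem_filter.mp hz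
  obtain ⟨h3, h4⟩ := Finset.mem_filter.mp h1
  exact ⟨h3, h4, h2⟩

/-- bookkeeping: the terms vanish off the ball, so the sum is over the ball. [folklore] -/
theorem sum_eq_sum_ball (hw0 : ∀ z, R < Site.tdist z y₀ → w z = 0) :
    ∑ z, |k z| * w z = ∑ z ∈ (univ : Finset (Site P j)).filter (fun z => Site.tdist z y₀ ≤ R), |k z| * w z := by
  classical
  rw [← Finset.sum_filter_add_sum_filter_not (univ : Finset (Site P j)) (fun z => Site.tdist z y₀ ≤ R)]
  have h0 : ∑ z ∈ (univ : Finset (Site P j)).filter (fun z => ¬ Site.tdist z y₀ ≤ R), |k z| * w z = 0 :=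
    Finset.sum_eq_zero fun z hz => by
      rw [Finset.mem_filter] at hz
      rw [hw0 z (by omega), mul_zero]
  rw [h0, add_zero]

/-- ★★ **a = 0 (bounded kernel, e.g. ∇G̃₂)**: `|k| ≤ c`, `0 ≤ w ≤ A(1∨r)⁻²` on the `R`-ball, `w = 0` off it ⇒ `Σ_z |k z|·w z ≤ c·A·(8 + 192R)`. [cite: Balaban1985RegularSpaces, (1.36) p.82] -/
theorem conv_bdd_le (hd : P.d = 3) (hc : 0 ≤ c) (hA : 0 ≤ A) (hk : ∀ z, |k z| ≤ c) (hw : ∀ z, 0 ≤ w z)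
    (hwA : ∀ z, w z ≤ A / (max 1 ((Site.tdist z y₀ : ℕ) : ℝ)) ^ 2) (hw0 : ∀ z, R < Site.tdist z y₀ → w z = 0) :
    ∑ z, |k z| * w z ≤ c * A * (8 + 192 * (R : ℝ)) := by
  classical
  rw [sum_eq_sum_ball y₀ R k w hw0]
  set S := (univ : Finset (Site P j)).filter (fun z => Site.tdist z y₀ ≤ R) with hSdef
  have hS : ∀ z ∈ S, Site.tdist z y₀ ≤ R := fun z hz => (Finset.mem_filter.mp hz).2
  calc ∑ z ∈ S, |k z| * w z ≤ ∑ z ∈ S, c * (A / (max 1 ((Site.tdist z y₀ : ℕ) : ℝ)) ^ 2) :=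
        Finset.sum_le_sum fun z _ => mul_le_mul (hk z) (hwA z) (hw z) hc
    _ = c * A * ∑ z ∈ S, ((max 1 ((Site.tdist z y₀ : ℕ) : ℝ)) ^ 2)⁻¹ := by
        rw [Finset.mul_sum]
        exact Finset.sum_congr rfl fun z _ => by rw [div_eq_mul_inv]; ring
    _ ≤ c * A * (8 + 192 * (R : ℝ)) := mul_le_mul_of_nonneg_left (sum_inv_max_sq_le hd S y₀ R hS) (mul_nonneg hc hA)

/-- ★★ **a = −1 (linearly growing kernel, the G̃₂ size row)**: `|k z| ≤ c(1 + tdist(z,x))`, `ρ := tdist(x,y₀)` ⇒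
`Σ_z |k z|·w z ≤ c·A·((1 + ρ)(8 + 192R) + (8 + 128R²))`. [cite: Balaban1985RegularSpaces, (1.36) p.82] -/
theorem conv_lin_le (hd : P.d = 3) (hc : 0 ≤ c) (hA : 0 ≤ A) (hk : ∀ z, |k z| ≤ c * (1 + ((Site.tdist z x : ℕ) : ℝ))) (hw : ∀ z, 0 ≤ w z)
    (hwA : ∀ z, w z ≤ A / (max 1 ((Site.tdist z y₀ : ℕ) : ℝ)) ^ 2) (hw0 : ∀ z, R < Site.tdist z y₀ → w z = 0) :
    ∑ z, |k z| * w z ≤ c * A * ((1 + ((Site.tdist x y₀ : ℕ) : ℝ)) * (8 + 192 * (R : ℝ)) + (8 + 128 * (R : ℝ) ^ 2)) := by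
  classical
  rw [sum_eq_sum_ball y₀ R k w hw0]
  set S := (univ : Finset (Site P j)).filter (fun z => Site.tdist z y₀ ≤ R) with hSdef
  have hS : ∀ z ∈ S, Site.tdist z y₀ ≤ R := fun z hz => (Finset.mem_filter.mp hz).2
  set ρ : ℝ := ((Site.tdist x y₀ : ℕ) : ℝ) with hρ
  -- pointwise: `|k z| w z ≤ cA (1+ρ)(1∨r)⁻² + cA (1∨r)⁻¹`
  have hpt : ∀ z ∈ S, |k z| * w z ≤ c * A * ((1 + ρ) * ((max 1 ((Site.tdist z y₀ : ℕ) : ℝ)) ^ 2)⁻¹ + (max 1 ((Site.tdist z y₀ : ℕ) : ℝ))⁻¹) := by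
    intro z _
    set r : ℝ := ((Site.tdist z y₀ : ℕ) : ℝ) with hr
    have hr0 : 0 ≤ r := Nat.cast_nonneg _
    have hm1 : 1 ≤ max 1 r := le_max_left _ _
    have hm0 : 0 < max 1 r := by linarith
    have hmr : r ≤ max 1 r := le_max_right _ _
    -- `tdist z x ≤ tdist z y₀ + tdist y₀ x = r + ρ`
    have htri : ((Site.tdist z x : ℕ) : ℝ) ≤ r + ρ := by
      have h := tdist_triangle z y₀ x
      rw [tdist_comm y₀ x] at h
      rw [hr, hρ]; exact_mod_cast h
    have hk' : |k z| ≤ c * (1 + ρ) + c * r := by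
      have := hk z; nlinarith
    have hw' := hwA z
    have hwz := hw z
    calc |k z| * w z ≤ (c * (1 + ρ) + c * r) * (A / (max 1 r) ^ 2) := mul_le_mul hk' hw' hwz (by positivity)
      _ = c * A * ((1 + ρ) * ((max 1 r) ^ 2)⁻¹) + c * A * (r * ((max 1 r) ^ 2)⁻¹) := by rw [div_eq_mul_inv]; ring
      _ ≤ c * A * ((1 + ρ) * ((max 1 r) ^ 2)⁻¹) + c * A * (max 1 r)⁻¹ := by
          refine add_le_add le_rfl (mul_le_mul_of_nonneg_left ?_ (mul_nonneg hc hA))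
          rw [sq, mul_inv, ← mul_assoc]
          calc r * (max 1 r)⁻¹ * (max 1 r)⁻¹ ≤ 1 * (max 1 r)⁻¹ := by
                refine mul_le_mul_of_nonneg_right ?_ (inv_nonneg.mpr hm0.le)
                rw [mul_inv_le_iff₀ hm0, one_mul]; exact hmr
            _ = (max 1 r)⁻¹ := one_mul _
      _ = _ := by ring
  calc ∑ z ∈ S, |k z| * w z ≤ ∑ z ∈ S, c * A * ((1 + ρ) * ((max 1 ((Site.tdist z y₀ : ℕ) : ℝ)) ^ 2)⁻¹ + (max 1 ((Site.tdist z y₀ : ℕ) : ℝ))⁻¹) :=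
        Finset.sum_le_sum hpt
    _ = c * A * ((1 + ρ) * ∑ z ∈ S, ((max 1 ((Site.tdist z y₀ : ℕ) : ℝ)) ^ 2)⁻¹ + ∑ z ∈ S, (max 1 ((Site.tdist z y₀ : ℕ) : ℝ))⁻¹) := by
        rw [← Finset.mul_sum, Finset.sum_add_distrib, Finset.mul_sum]
    _ ≤ c * A * ((1 + ρ) * (8 + 192 * (R : ℝ)) + (8 + 128 * (R : ℝ) ^ 2)) := by
        have hρ0 : 0 ≤ ρ := Nat.cast_nonneg _
        refine mul_le_mul_of_nonneg_left (add_le_add ?_ (sum_inv_max_le hd S y₀ R hS)) (mul_nonneg hc hA)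
        exact mul_le_mul_of_nonneg_left (sum_inv_max_sq_le hd S y₀ R hS) (by linarith)

/-- geometry of the split: in region A (`r_z ≤ t_z`) the kernel variable is at least half of `ρ`: `(1 ∨ ρ) ≤ 2·(1 ∨ t_z)`. [folklore] -/
theorem max_rho_le_two_max_of_le (z : Site P j) (hA' : Site.tdist z y₀ ≤ Site.tdist z x) :
    max 1 ((Site.tdist x y₀ : ℕ) : ℝ) ≤ 2 * max 1 ((Site.tdist z x : ℕ) : ℝ) := by
  have h := tdist_triangle x z y₀
  rw [tdist_comm x z] at h
  have h2 : ((Site.tdist x y₀ : ℕ) : ℝ) ≤ ((Site.tdist z x : ℕ) : ℝ) + ((Site.tdist z y₀ : ℕ) : ℝ) := by exact_mod_cast h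
  have h3 : ((Site.tdist z y₀ : ℕ) : ℝ) ≤ ((Site.tdist z x : ℕ) : ℝ) := by exact_mod_cast hA'
  have h4 := le_max_left (1 : ℝ) ((Site.tdist z x : ℕ) : ℝ)
  have h5 := le_max_right (1 : ℝ) ((Site.tdist z x : ℕ) : ℝ)
  exact max_le (by linarith) (by linarith)

/-- … and in region B (`t_z < r_z`) the density variable is: `(1 ∨ ρ) ≤ 2·(1 ∨ r_z)`. [folklore] -/
theorem max_rho_le_two_max_of_lt (z : Site P j) (hB' : Site.tdist z x < Site.tdist z y₀) :
    max 1 ((Site.tdist x y₀ : ℕ) : ℝ) ≤ 2 * max 1 ((Site.tdist z y₀ : ℕ) : ℝ) := by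
  have h := tdist_triangle x z y₀
  rw [tdist_comm x z] at h
  have h2 : ((Site.tdist x y₀ : ℕ) : ℝ) ≤ ((Site.tdist z x : ℕ) : ℝ) + ((Site.tdist z y₀ : ℕ) : ℝ) := by exact_mod_cast h
  have h3 : ((Site.tdist z x : ℕ) : ℝ) ≤ ((Site.tdist z y₀ : ℕ) : ℝ) := by exact_mod_cast hB'.le
  have h4 := le_max_left (1 : ℝ) ((Site.tdist z y₀ : ℕ) : ℝ)
  have h5 := le_max_right (1 : ℝ) ((Site.tdist z y₀ : ℕ) : ℝ)
  exact max_le (by linarith) (by linarith)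

/-- the half radius: `(1 ∨ ρ) ≤ 2·(⌊ρ∕2⌋ + 1)`. [folklore] -/
theorem max_rho_le_two_half_add_one : max 1 ((Site.tdist x y₀ : ℕ) : ℝ) ≤ 2 * (((Site.tdist x y₀ / 2 : ℕ) : ℝ) + 1) := by
  have h : Site.tdist x y₀ ≤ 2 * (Site.tdist x y₀ / 2) + 1 := by omega
  have h2 : ((Site.tdist x y₀ : ℕ) : ℝ) ≤ 2 * ((Site.tdist x y₀ / 2 : ℕ) : ℝ) + 1 := by exact_mod_cast h
  have h3 : (0 : ℝ) ≤ ((Site.tdist x y₀ / 2 : ℕ) : ℝ) := Nat.cast_nonneg _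
  exact max_le (by linarith) (by linarith)

end Conv

/-! ## §3 The matrix ∕ vector corollary -/

/-- ★★ **VECTOR-VALUED DENSITIES**: `‖Σ_z k z • J z‖ ≤ Σ_z |k z|·‖J z‖`, so every §2 bound applies to `‖Σ_z k(x,z) • J z‖` with `w := ‖J ·‖` (`‖J z‖ ≤ A(1∨r_z)⁻²` on the ball, `J = 0` off it).
[cite: Balaban1985RegularSpaces, (1.36) p.82] -/
theorem norm_sum_smul_le_of_conv {V : Type*} [SeminormedAddCommGroup V] [NormedSpace ℝ V] (k : Site P j → ℝ) (J : Site P j → V) {B : ℝ}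
    (h : ∑ z, |k z| * ‖J z‖ ≤ B) : ‖∑ z, k z • J z‖ ≤ B := by
  refine (norm_sum_le _ _).trans (le_trans (Finset.sum_le_sum fun z _ => ?_) h)
  rw [norm_smul, Real.norm_eq_abs]

end Summit.QuantumFields.YangMills.Theorems.Prop7TorusGreenConvolution

end
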